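import Summits.Ventures.PercRepro.Night2LocalR1Defs
import Summits.Ventures.PercRepro.Night2LocalSimpleCount3
import Summits.Ventures.PercRepro.Night2LocalPlaneFacts

/-!
# PercRepro — the geometry of a type-`(2, 1)` flat (night-2, gen 10)

`G` a rank-`4` flat with `|E ∖ G| = 2` and a coloop `y` of `M|G` (`y ∉ cl (G ∖ {y})`); `P := G ∖ {y}` is then a
rank-`3` flat.  Facts used by the R1 column bounds (proofs/NIGHT-2-r1.md §3):

* every member `B` (of `Uq M 5 3` with `cl B ⊆ G`) has `ρ(B) = 3`, `B ⊆ G` and `ρ(G ∖ B) ≥ 3`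
  (`three_le_rkN_sdiff_of_member`: `E ∖ B ⊆ (G ∖ B) ∪ (E ∖ G)`);
* every shadow set `S` at `G` contains `y`, and `U := S ∖ {y}` has rank `3` (`rkN_erase_of_mem_shadowAt`);
* a member avoiding `y` has closure `P` (`clF_eq_erase_of_member_notMem`), so `|G ∖ cl B| = 1`;
* for `K ⊆ P`, `G ∖ cl (K ∪ {y}) = P ∖ cl K` (`sdiff_clF_insert_coloop`: the rank of `K ∪ {y, p}` is `ρ(K) + 2`
  for `p ∈ P ∖ cl K`);
* the covering preimages of `S` are the sets `S ∖ {z}`, `z` a coloop of `S` with `S ∖ {z}` a member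
  (`coverPreimages_eq_image`), and the column's covering part is the sum over those coloops
  (`sum_coverPreimages_eq`).
-/

namespace PercRepro.Shadow

open Finset PerFlat ThmH

variable {α : Type*} [DecidableEq α] {M : Matroid α} [M.Finite]

/-- Adding a ground element outside the closure raises the rank by one. -/
theorem rkN_insert_of_notMem_clF {K : Finset α} {p : α} (hp : p ∈ gr M) (hpK : p ∉ clF M K) :
    rkN M (insert p K) = rkN M K + 1 := by
  have hpE : p ∈ M.E \ M.closure (K : Set α) := by
    refine ⟨by rw [← coe_gr]; exact_mod_cast hp, ?_⟩
    rw [← coe_clF]; exact_mod_cast hpK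
  have h := M.eRk_insert_eq_add_one hpE
  rw [← Finset.coe_insert, eRk_eq_rkN, eRk_eq_rkN] at h
  exact_mod_cast h

/-- `ρ(X ∪ Y) ≤ ρ(X) + |Y|`. -/
theorem rkN_union_le_add_card (X Y : Finset α) : rkN M (X ∪ Y) ≤ rkN M X + Y.card := by
  have h1 := rkN_submod (M := M) X Y
  have h2 := rkN_le_card (M := M) Y
  omega

/-! ## Members at a rank-`4` flat with `|E ∖ G| = 2` -/

/-- Members have rank `3`. -/
theorem rkN_eq_three_of_member {G B : Finset α} (hB : B ∈ membersIn M (Uq M 5 3) G) : rkN M B = 3 := by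
  unfold rkN; rw [(mem_Uq.1 (mem_membersIn.1 hB).1).2.1]; rfl

/-- Members lie in the ground set. -/
theorem subset_gr_of_member {G B : Finset α} (hB : B ∈ membersIn M (Uq M 5 3) G) : B ⊆ gr M :=
  (mem_Uq.1 (mem_membersIn.1 hB).1).1

/-- Members lie in `G`. -/
theorem subset_of_member {G B : Finset α} (hB : B ∈ membersIn M (Uq M 5 3) G) : B ⊆ G :=
  (subset_clF_of_subset_gr (subset_gr_of_member hB)).trans (mem_membersIn.1 hB).2

/-- A member at a flat `G` with `|E ∖ G| = 2` has `ρ(G ∖ B) ≥ 3`. -/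
theorem three_le_rkN_sdiff_of_member {G : Finset α} (hd : (gr M \ G).card = 2) {B : Finset α}
    (hB : B ∈ membersIn M (Uq M 5 3) G) : 3 ≤ rkN M (G \ B) := by
  have hBU := (mem_membersIn.1 hB).1
  have h5 : rkN M (gr M \ B) = 5 := by unfold rkN; rw [(mem_Uq.1 hBU).2.2]; rfl
  have hsub : gr M \ B ⊆ (G \ B) ∪ (gr M \ G) := by
    intro e he
    rw [Finset.mem_sdiff] at he
    rw [Finset.mem_union, Finset.mem_sdiff, Finset.mem_sdiff]
    by_cases heG : e ∈ G
    · exact Or.inl ⟨heG, he.2⟩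
    · exact Or.inr ⟨he.1, heG⟩
  have h1 := rkN_mono (M := M) hsub
  have h2 := rkN_union_le_add_card (M := M) (G \ B) (gr M \ G)
  omega

/-- Hence `|G ∖ B| ≥ 3` for a member. -/
theorem three_le_card_sdiff_of_member {G : Finset α} (hd : (gr M \ G).card = 2) {B : Finset α}
    (hB : B ∈ membersIn M (Uq M 5 3) G) : 3 ≤ (G \ B).card :=
  (three_le_rkN_sdiff_of_member hd hB).trans (rkN_le_card _)

/-! ## Shadow sets -/

/-- Shadow sets lie in the ground set. -/
theorem subset_gr_of_mem_shadowAt {p q : ℕ} {𝒜 : Finset (Finset α)} {G S : Finset α}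
    (hS : S ∈ shadowAt M p q 𝒜 G) : S ⊆ gr M := by
  have h := (mem_shadow.1 (mem_shadowAt.1 hS).1).1
  unfold Yq at h
  rw [Finset.mem_filter, Finset.mem_powerset] at h
  exact h.1

/-- Shadow sets at the diagonal `(5, 3)` have rank `4`. -/
theorem rkN_eq_four_of_mem_shadowAt {𝒜 : Finset (Finset α)} {G S : Finset α}
    (hS : S ∈ shadowAt M 5 3 𝒜 G) : rkN M S = 4 := by
  have h := eRk_eq_of_mem_Yq_diag (q := 3) (mem_shadow.1 (mem_shadowAt.1 hS).1).1
  unfold rkN; rw [h]; rfl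

/-! ## The coloop `y` of `M|G` -/

/-- `G ∖ {y}` has rank `3`. -/
theorem rkN_erase_coloop {G : Finset α} (hG : G ∈ flatsQ M 4) {y : α} (hyG : y ∈ G)
    (hycl : y ∉ clF M (G.erase y)) : rkN M (G.erase y) = 3 := by
  have hGg := (mem_flatsQ.1 hG).1
  have h := rkN_insert_of_notMem_clF_erase hGg hyG hycl (X := G.erase y) (Finset.Subset.refl _)
  rw [Finset.insert_erase hyG] at h
  have hG4 : rkN M G = 4 := by unfold rkN; rw [(mem_flatsQ.1 hG).2.2]; rfl
  omega

/-- `G ∖ {y}` is a flat. -/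
theorem clF_erase_coloop {G : Finset α} (hG : G ∈ flatsQ M 4) {y : α} (hyG : y ∈ G)
    (hycl : y ∉ clF M (G.erase y)) : clF M (G.erase y) = G.erase y := by
  have hGg := (mem_flatsQ.1 hG).1
  apply le_antisymm
  · intro e he
    have heG : e ∈ G := (clF_mono (Finset.erase_subset _ _)).trans (clF_subset_self_of_mem_flatsQ hG) he
    rw [Finset.mem_erase]
    refine ⟨?_, heG⟩
    rintro rfl
    exact hycl he
  · exact subset_clF_of_subset_gr ((Finset.erase_subset _ _).trans hGg)

/-- `G ∖ {y}` is a rank-`3` flat. -/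
theorem erase_coloop_mem_flatsQ {G : Finset α} (hG : G ∈ flatsQ M 4) {y : α} (hyG : y ∈ G)
    (hycl : y ∉ clF M (G.erase y)) : G.erase y ∈ flatsQ M 3 := by
  have hGg := (mem_flatsQ.1 hG).1
  rw [mem_flatsQ]
  refine ⟨(Finset.erase_subset _ _).trans hGg, ?_, ?_⟩
  · rw [Matroid.isFlat_iff_closure_eq, ← coe_clF, clF_erase_coloop hG hyG hycl]
  · rw [eRk_eq_rkN, rkN_erase_coloop hG hyG hycl]

/-- Every shadow set at `G` contains the coloop `y`. -/
theorem mem_of_mem_shadowAt_coloop {G : Finset α} {y : α} (hyG : y ∈ G) (hycl : y ∉ clF M (G.erase y))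
    {𝒜 : Finset (Finset α)} {S : Finset α} (hS : S ∈ shadowAt M 5 3 𝒜 G) : y ∈ S := by
  by_contra hyS
  have hcl : clF M S = G := (mem_shadowAt.1 hS).2
  have hSG : S ⊆ G := subset_of_mem_shadowAt hS
  have hS' : S ⊆ G.erase y := fun e he => Finset.mem_erase.2 ⟨fun h => hyS (h ▸ he), hSG he⟩
  have : y ∈ clF M (G.erase y) := clF_mono hS' (hcl ▸ hyG)
  exact hycl this

/-- `S ∖ {y}` lies in `G ∖ {y}`. -/
theorem erase_subset_erase_of_mem_shadowAt {G : Finset α} {y : α} {𝒜 : Finset (Finset α)} {S : Finset α}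
    (hS : S ∈ shadowAt M 5 3 𝒜 G) : S.erase y ⊆ G.erase y := by
  intro e he
  rw [Finset.mem_erase] at he ⊢
  exact ⟨he.1, subset_of_mem_shadowAt hS he.2⟩

/-- `U := S ∖ {y}` has rank `3`. -/
theorem rkN_erase_of_mem_shadowAt {G : Finset α} (hG : G ∈ flatsQ M 4) {y : α} (hyG : y ∈ G)
    (hycl : y ∉ clF M (G.erase y)) {𝒜 : Finset (Finset α)} {S : Finset α} (hS : S ∈ shadowAt M 5 3 𝒜 G) :
    rkN M (S.erase y) = 3 := by
  have hGg := (mem_flatsQ.1 hG).1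
  have hyS := mem_of_mem_shadowAt_coloop hyG hycl hS
  have h := rkN_insert_of_notMem_clF_erase hGg hyG hycl (erase_subset_erase_of_mem_shadowAt (y := y) hS)
  rw [Finset.insert_erase hyS, rkN_eq_four_of_mem_shadowAt hS] at h
  omega

/-- `y ∉ cl (S ∖ {y})` for a shadow set `S`. -/
theorem coloop_notMem_clF_erase_of_mem_shadowAt {G : Finset α} {y : α}
    (hycl : y ∉ clF M (G.erase y)) {𝒜 : Finset (Finset α)} {S : Finset α} (hS : S ∈ shadowAt M 5 3 𝒜 G) :
    y ∉ clF M (S.erase y) :=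
  fun h => hycl (clF_mono (erase_subset_erase_of_mem_shadowAt hS) h)

/-! ## Members and the coloop -/

/-- A member avoiding `y` has closure `G ∖ {y}`. -/
theorem clF_eq_erase_of_member_notMem {G : Finset α} (hG : G ∈ flatsQ M 4) {y : α} (hyG : y ∈ G)
    (hycl : y ∉ clF M (G.erase y)) {B : Finset α} (hB : B ∈ membersIn M (Uq M 5 3) G) (hyB : y ∉ B) :
    clF M B = G.erase y := by
  have hBG : B ⊆ G := subset_of_member hB
  have hB' : B ⊆ G.erase y := fun e he => Finset.mem_erase.2 ⟨fun h => hyB (h ▸ he), hBG he⟩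
  have hsub : clF M B ⊆ G.erase y := by
    have := clF_mono (M := M) hB'
    rwa [clF_erase_coloop hG hyG hycl] at this
  apply flat_eq_of_subset_of_eRk_eq (q := 2) (erase_coloop_mem_flatsQ hG hyG hycl) _ hsub
  · rw [coe_clF, M.eRk_closure_eq, eRk_eq_rkN, rkN_eq_three_of_member hB]
  · rw [coe_clF]; exact M.isFlat_closure _

/-- Hence `|G ∖ cl B| = 1` for a member avoiding `y`. -/
theorem card_sdiff_clF_eq_one_of_member_notMem {G : Finset α} (hG : G ∈ flatsQ M 4) {y : α} (hyG : y ∈ G)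
    (hycl : y ∉ clF M (G.erase y)) {B : Finset α} (hB : B ∈ membersIn M (Uq M 5 3) G) (hyB : y ∉ B) :
    (G \ clF M B).card = 1 := by
  rw [clF_eq_erase_of_member_notMem hG hyG hycl hB hyB, Finset.sdiff_erase_self hyG, Finset.card_singleton]

/-- For `K ⊆ G ∖ {y}`: `G ∖ cl (K ∪ {y}) = (G ∖ {y}) ∖ cl K`. -/
theorem sdiff_clF_insert_coloop {G : Finset α} (hG : G ∈ flatsQ M 4) {y : α} (hyG : y ∈ G)
    (hycl : y ∉ clF M (G.erase y)) {K : Finset α} (hK : K ⊆ G.erase y) :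
    G \ clF M (insert y K) = (G.erase y) \ clF M K := by
  have hGg := (mem_flatsQ.1 hG).1
  have hKg : K ⊆ gr M := hK.trans ((Finset.erase_subset _ _).trans hGg)
  ext p
  simp only [Finset.mem_sdiff, Finset.mem_erase]
  constructor
  · rintro ⟨hpG, hp⟩
    refine ⟨⟨?_, hpG⟩, ?_⟩
    · rintro rfl
      exact hp (subset_clF_of_subset_gr (Finset.insert_subset (hGg hyG) hKg) (Finset.mem_insert_self _ _))
    · intro hpK
      exact hp (clF_mono (Finset.subset_insert _ _) hpK)
  · rintro ⟨⟨hpy, hpG⟩, hp⟩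
    refine ⟨hpG, fun hpcl => ?_⟩
    have hyKg : insert y K ⊆ gr M := Finset.insert_subset (hGg hyG) hKg
    have h1 : rkN M (insert p (insert y K)) ≤ rkN M (insert y K) := rkN_insert_le_of_mem_clF hyKg hpcl
    have h2 : rkN M (insert y K) = rkN M K + 1 := rkN_insert_of_notMem_clF_erase hGg hyG hycl hK
    have hpK' : insert p K ⊆ G.erase y :=
      Finset.insert_subset (Finset.mem_erase.2 ⟨hpy, hpG⟩) hK
    have h3 : rkN M (insert y (insert p K)) = rkN M (insert p K) + 1 :=
      rkN_insert_of_notMem_clF_erase hGg hyG hycl hpK'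
    have h4 : rkN M (insert p K) = rkN M K + 1 := rkN_insert_of_notMem_clF (hGg hpG) hp
    rw [Finset.insert_comm] at h1
    omega

/-- A member containing `y` is `K ∪ {y}` with `K = B ∖ {y} ⊆ G ∖ {y}` of rank `2`. -/
theorem rkN_erase_of_member_mem {G : Finset α} (hG : G ∈ flatsQ M 4) {y : α} (hyG : y ∈ G)
    (hycl : y ∉ clF M (G.erase y)) {B : Finset α} (hB : B ∈ membersIn M (Uq M 5 3) G) (hyB : y ∈ B) :
    rkN M (B.erase y) = 2 := by
  have hGg := (mem_flatsQ.1 hG).1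
  have hK : B.erase y ⊆ G.erase y := fun e he => by
    rw [Finset.mem_erase] at he ⊢; exact ⟨he.1, subset_of_member hB he.2⟩
  have h := rkN_insert_of_notMem_clF_erase hGg hyG hycl hK
  rw [Finset.insert_erase hyB, rkN_eq_three_of_member hB] at h
  omega

/-- For a member `B ∋ y`: `|G ∖ cl B| = |(G ∖ {y}) ∖ cl (B ∖ {y})|`. -/
theorem card_sdiff_clF_of_member_mem {G : Finset α} (hG : G ∈ flatsQ M 4) {y : α} (hyG : y ∈ G)
    (hycl : y ∉ clF M (G.erase y)) {B : Finset α} (hB : B ∈ membersIn M (Uq M 5 3) G) (hyB : y ∈ B) :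
    (G \ clF M B).card = ((G.erase y) \ clF M (B.erase y)).card := by
  have hK : B.erase y ⊆ G.erase y := fun e he => by
    rw [Finset.mem_erase] at he ⊢; exact ⟨he.1, subset_of_member hB he.2⟩
  conv_lhs => rw [← Finset.insert_erase hyB]
  rw [sdiff_clF_insert_coloop hG hyG hycl hK]

/-! ## Covering preimages are coloop deletions -/

/-- A covering set of a bottom set is `S` with `B = S ∖ {z}` for a coloop `z ∉ B` of `S`. -/
theorem exists_erase_of_mem_coverSets {G B S : Finset α} (hBU : B ∈ Uq M 5 3) (hS : S ∈ coverSets M B G) :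
    ∃ z ∈ S, z ∉ B ∧ B = S.erase z ∧ z ∉ clF M B := by
  obtain ⟨z, hz, rfl⟩ := mem_coverSets.1 hS
  rw [Finset.mem_sdiff] at hz
  have hzB : z ∉ B := notMem_of_notMem_clF (q := 3) hBU hz.2
  exact ⟨z, Finset.mem_insert_self _ _, hzB, (Finset.erase_insert hzB).symm, hz.2⟩

open scoped Classical in
/-- **The covering preimages of a shadow set `S`** are the sets `S ∖ {z}` for the coloops `z` of `S` with
`S ∖ {z}` a member. -/
theorem coverPreimages_eq_image {G : Finset α} {𝒜 : Finset (Finset α)} (h𝒜 : 𝒜 ⊆ Uq M 5 3) {S : Finset α}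
    (hS : S ∈ shadowAt M 5 3 𝒜 G) :
    coverPreimages M 𝒜 G S =
      ((coloops M S).filter (fun z => S.erase z ∈ membersIn M 𝒜 G)).image (fun z => S.erase z) := by
  ext B
  rw [mem_coverPreimages, Finset.mem_image]
  constructor
  · rintro ⟨hB, hcov⟩
    obtain ⟨z, hzS, -, rfl, hzcl⟩ := exists_erase_of_mem_coverSets (h𝒜 (mem_membersIn.1 hB).1) hcov
    exact ⟨z, Finset.mem_filter.2 ⟨mem_coloops.2 ⟨hzS, hzcl⟩, hB⟩, rfl⟩
  · rintro ⟨z, hz, rfl⟩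
    rw [Finset.mem_filter, mem_coloops] at hz
    refine ⟨hz.2, ?_⟩
    rw [mem_coverSets]
    exact ⟨z, Finset.mem_sdiff.2 ⟨subset_of_mem_shadowAt hS hz.1.1, hz.1.2⟩, Finset.insert_erase hz.1.1⟩

open scoped Classical in
/-- The covering part of a column is the sum over the coloops `z` of `S` whose deletion is a member. -/
theorem sum_coverPreimages_eq {G : Finset α} {𝒜 : Finset (Finset α)} (h𝒜 : 𝒜 ⊆ Uq M 5 3) {S : Finset α}
    (hS : S ∈ shadowAt M 5 3 𝒜 G) (f : Finset α → ℚ) :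
    ∑ B ∈ coverPreimages M 𝒜 G S, f B =
      ∑ z ∈ (coloops M S).filter (fun z => S.erase z ∈ membersIn M 𝒜 G), f (S.erase z) := by
  rw [coverPreimages_eq_image h𝒜 hS]
  apply Finset.sum_image
  intro z hz z' hz' h
  rw [Finset.coe_filter, Set.mem_setOf_eq] at hz hz'
  exact (Finset.erase_inj S (mem_coloops.1 hz.1).1).1 h

open scoped Classical in
/-- The column of a weight of the form «`c(B)` on each covering set» equals the sum over those coloops. -/
theorem sum_ite_coverSets_col {G : Finset α} {𝒜 : Finset (Finset α)} (h𝒜 : 𝒜 ⊆ Uq M 5 3) {S : Finset α}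
    (hS : S ∈ shadowAt M 5 3 𝒜 G) (c : Finset α → ℚ) :
    ∑ B ∈ membersIn M 𝒜 G, (if S ∈ coverSets M B G then c B else 0) =
      ∑ z ∈ (coloops M S).filter (fun z => S.erase z ∈ membersIn M 𝒜 G), c (S.erase z) := by
  rw [← Finset.sum_filter, ← sum_coverPreimages_eq h𝒜 hS]
  rfl

/-- A coloop `z ≠ y` of a shadow set `S` gives a rank-`2` set `(S ∖ {y}) ∖ {z}`. -/
theorem rkN_erase_erase_eq_two {G : Finset α} {y : α} (hycl : y ∉ clF M (G.erase y))
    {𝒜 : Finset (Finset α)} {S : Finset α} (hS : S ∈ shadowAt M 5 3 𝒜 G) (hyS : y ∈ S) {z : α}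
    (hz : z ∈ coloops M S) (hzy : z ≠ y) : rkN M ((S.erase y).erase z) = 2 := by
  have h := rkN_erase_erase_of_mem_coloops (subset_gr_of_mem_shadowAt hS) hyS
    (coloop_notMem_clF_erase_of_mem_shadowAt hycl hS) hz hzy
  rw [rkN_eq_four_of_mem_shadowAt hS] at h
  omega

/-- The pairs of a set of a simple flat have rank `2`. -/
theorem simple_of_subset {G U : Finset α} (hsimple : ∀ e ∈ G, ∀ f ∈ G, e ≠ f → rkN M {e, f} = 2)
    (hU : U ⊆ G) : ∀ e ∈ U, ∀ f ∈ U, e ≠ f → rkN M {e, f} = 2 :=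
  fun e he f hf hef => hsimple e (hU he) f (hU hf) hef

end PercRepro.Shadow
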